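import Mathlib.Algebra.Order.Archimedean.Basic
import Mathlib.Data.NNRat.Order
import Mathlib.Data.NNReal.Defs
import Mathlib.Algebra.Group.Equiv.TypeTags
import Literature.AlgebraicGeometry.Frobenioids.Monoids
import HarnessLib

/-!
# Rigidity of monoprime monoids: an automorphism fixing a non-unit is the identity

Mochizuki, *The geometry of Frobenioids I: the general theory*, Kyushu J. Math. **62** (2008)
293–400, §0 p. 10 (monoprime monoids `≅ ℤ_{≥0}, ℚ_{≥0}, ℝ_{≥0}`) and the proof of Thm. 4.9, p. 90
ll. 1–4 [cite: MochizukiFrdI2008, Thm. 4.9 p.90]: "it suffices to show, for each `𝔭 ∈ Prime(Φ₁(A))`, the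
existence of twin-primary steps with zero divisor in `𝔭` that are mapped by `Ψ` to twin-primary steps"
— i.e. two isomorphisms `Φ₁(A)_𝔭 ≅ Φ₂(Ψ A)_𝔭'` of MONOPRIME monoids (the right-hand and left-hand
isomorphisms of Thm. 4.2 (iii)) that agree at ONE non-trivial element coincide. This file proves that
rigidity ("well-known structure of the monoids `ℚ_{≥0}`, `ℝ_{≥0}`", p. 81) uniformly for archimedean,
canonically and linearly ordered, cancellative additive monoids (`ℤ_{≥0}`, `ℚ_{≥0}`, `ℝ_{≥0}` at once):

* `addEquiv_eq_refl_of_map_eq` — an additive automorphism with a non-zero fixed point is the identity;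
* `IsMonoprime.mulEquiv_eq_of_apply_eq` — two isomorphisms `P ≃* Q` out of a monoprime monoid that
  agree at some `t ≠ 1` are equal.

PROOF-ONLY file (seat abc-iut-w4-d105; D-0068 sub-DAG S5, row `FrdI:Thm4.9/T49-L06`
`TwinPrimaryCriterion`, piece). Companion of `MonoprimeEquivMul.lean` (seat abc-iut-L1-d10). No new
definitions; nothing of [FrdI] is restated.
-/

namespace Literature.AlgebraicGeometry.Frobenioids

open Function

/-! ### Additive form: archimedean canonically linearly ordered cancellative monoids -/

section Additive

variable {Λ : Type*} [AddCommMonoid Λ] [LinearOrder Λ] [CanonicallyOrderedAdd Λ]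
  [IsOrderedCancelAddMonoid Λ] [Archimedean Λ]

omit [LinearOrder Λ] [CanonicallyOrderedAdd Λ] [IsOrderedCancelAddMonoid Λ] [Archimedean Λ] in
/-- An additive map into a canonically ordered monoid is monotone for the divisibility preorder of the
source: `x ≤ y := ∃ c, y = x + c` (here both sides canonically ordered). [folklore] -/
private theorem monotone_of_map_add [PartialOrder Λ] [CanonicallyOrderedAdd Λ] {Λ' : Type*} [AddCommMonoid Λ']
    [PartialOrder Λ'] [CanonicallyOrderedAdd Λ'] {F : Type*} [FunLike F Λ Λ'] [AddHomClass F Λ Λ']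
    (h : F) : Monotone h := by
  intro x y hxy
  obtain ⟨c, rfl⟩ := le_iff_exists_add.mp hxy
  rw [map_add]
  exact le_self_add

/-- An additive automorphism with a non-zero fixed point `a` has no point `y` with `y < h y`: for such
a `y` some multiple `m • a` would separate `n • y < m • a ≤ n • h y = h (n • y)`, contradicting
`h (m • a) = m • a` and the monotonicity of `h⁻¹`. [folklore] -/
private theorem not_lt_map_of_map_eq (h : Λ ≃+ Λ) {a : Λ} (ha : a ≠ 0) (hfix : h a = a) (y : Λ) :
    ¬ y < h y := by
  classical
  intro hy
  have ha0 : 0 < a := lt_of_le_of_ne zero_le (Ne.symm ha)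
  -- `h y = y + c` with `c > 0`
  obtain ⟨c, hc⟩ := le_iff_exists_add.mp hy.le
  have hc0 : 0 < c := by
    rcases eq_or_lt_of_le (zero_le (a := c)) with h0 | h0
    · exact absurd (by rw [hc, ← h0, add_zero]) hy.ne
    · exact h0
  -- `a ≤ n • c`
  obtain ⟨n, hn⟩ := Archimedean.arch a hc0
  -- the least `m` with `n • y < m • a`
  have hex : ∃ m : ℕ, n • y < m • a := by
    obtain ⟨K, hK⟩ := Archimedean.arch (n • y) ha0
    exact ⟨K + 1, lt_of_le_of_lt hK (by rw [succ_nsmul]; exact lt_add_of_pos_right _ ha0)⟩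
  have hm := Nat.find_spec hex
  have hmpos : 0 < Nat.find hex := by
    rcases Nat.eq_zero_or_pos (Nat.find hex) with h0 | h0
    · rw [h0, zero_nsmul] at hm; exact absurd hm (not_lt.mpr zero_le)
    · exact h0
  obtain ⟨k, hk⟩ := Nat.exists_eq_succ_of_ne_zero hmpos.ne'
  have hk' : k • a ≤ n • y := not_lt.mp (Nat.find_min hex (show k < Nat.find hex by omega))
  -- `m • a ≤ n • y + a ≤ n • y + n • c = n • h y = h (n • y)`
  have h1 : Nat.find hex • a ≤ h (n • y) := by
    rw [hk, succ_nsmul, map_nsmul, hc, nsmul_add]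
    exact add_le_add hk' hn
  -- but `m • a = h (m • a)`, and `h` reflects `≤`
  have h2 : h (Nat.find hex • a) ≤ h (n • y) := by rwa [map_nsmul, hfix]
  have h3 : Nat.find hex • a ≤ n • y := by
    simpa only [AddEquiv.symm_apply_apply] using monotone_of_map_add h.symm h2
  exact absurd hm (not_lt.mpr h3)

/-- **An additive automorphism of an archimedean, canonically and linearly ordered, cancellative monoid
with a non-zero fixed point is the identity** (the monoids `ℤ_{≥0}`, `ℚ_{≥0}`, `ℝ_{≥0}` of [FrdI] §0
p. 10 at once). [cite: MochizukiFrdI2008, §0 p.10] -/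
theorem addEquiv_eq_refl_of_map_eq (h : Λ ≃+ Λ) {a : Λ} (ha : a ≠ 0) (hfix : h a = a) :
    h = AddEquiv.refl Λ := by
  ext y
  rcases lt_trichotomy y (h y) with hlt | heq | hgt
  · exact absurd hlt (not_lt_map_of_map_eq h ha hfix y)
  · exact heq.symm
  · -- apply the first case to `h⁻¹` at the point `h y`
    have hfix' : h.symm a = a := by
      conv_lhs => rw [← hfix]
      exact h.symm_apply_apply a
    have := not_lt_map_of_map_eq h.symm ha hfix' (h y)
    rw [h.symm_apply_apply] at this
    exact absurd hgt this

end Additive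

/-! ### Monoprime monoids -/

section Monoprime

variable {P Q : Type*} [CommMonoid P] [CommMonoid Q]

/-- Transport: an automorphism of `P ≅ (Λ, +)` (`Λ` as above) fixing a non-unit is the identity.
[cite: MochizukiFrdI2008, §0 p.10] -/
theorem mulEquiv_eq_refl_of_apply_eq_of_mulEquiv {Λ : Type*} [AddCommMonoid Λ] [LinearOrder Λ]
    [CanonicallyOrderedAdd Λ] [IsOrderedCancelAddMonoid Λ] [Archimedean Λ]
    (e : P ≃* Multiplicative Λ) (g : P ≃* P) {t : P} (ht : t ≠ 1) (hfix : g t = t) :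
    g = MulEquiv.refl P := by
  -- the additive automorphism `h = e ∘ g ∘ e⁻¹` of `Λ` fixes `a = e t ≠ 0`
  let h : Λ ≃+ Λ := AddEquiv.toMultiplicative.symm (e.symm.trans (g.trans e))
  have happ : ∀ x : Λ, h x = Multiplicative.toAdd (e (g (e.symm (Multiplicative.ofAdd x)))) :=
    fun x => rfl
  have ha : Multiplicative.toAdd (e t) ≠ 0 := by
    intro h0
    apply ht
    have h1 : e t = 1 := by rw [← ofAdd_toAdd (e t), h0]; rfl
    simpa using congrArg e.symm h1
  have hfix' : h (Multiplicative.toAdd (e t)) = Multiplicative.toAdd (e t) := by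
    rw [happ, ofAdd_toAdd, MulEquiv.symm_apply_apply, hfix]
  have key := addEquiv_eq_refl_of_map_eq h ha hfix'
  ext x
  have hx := AddEquiv.congr_fun key (Multiplicative.toAdd (e x))
  rw [happ, ofAdd_toAdd, MulEquiv.symm_apply_apply, AddEquiv.refl_apply] at hx
  -- unwrap: `toAdd (e (g x)) = toAdd (e x)`
  have hx' : e (g x) = e x := Multiplicative.toAdd.injective hx
  simpa using congrArg e.symm hx'

/-- **Rigidity of monoprime monoids**: two isomorphisms of monoids `g₁, g₂ : P ≃* Q` out of a
MONOPRIME monoid `P` (`≅ ℤ_{≥0}`, `ℚ_{≥0}` or `ℝ_{≥0}`, [FrdI] §0 p. 10) that agree at one element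
`t ≠ 1` are equal — the step "it suffices to show … the existence of twin-primary steps … mapped by `Ψ`
to twin-primary steps" of the proof of Thm. 4.9 (p. 90 ll. 1–4: the right-hand and left-hand
isomorphisms of Thm. 4.2 (iii) agree at the zero divisor of a twin-primary pair, hence coincide).
[cite: MochizukiFrdI2008, Thm. 4.9 p.90] -/
theorem IsMonoprime.mulEquiv_eq_of_apply_eq (hP : IsMonoprime P) (g₁ g₂ : P ≃* Q) {t : P}
    (ht : t ≠ 1) (h : g₁ t = g₂ t) : g₁ = g₂ := by
  -- `g := g₁ ≫ g₂⁻¹` fixes `t`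
  have hfix : (g₁.trans g₂.symm) t = t := by
    rw [MulEquiv.trans_apply, h, MulEquiv.symm_apply_apply]
  have hg : g₁.trans g₂.symm = MulEquiv.refl P := by
    rcases hP with ⟨⟨⟨e⟩⟩⟩ | ⟨⟨⟨e⟩⟩⟩ | ⟨⟨⟨e⟩⟩⟩
    all_goals exact mulEquiv_eq_refl_of_apply_eq_of_mulEquiv e _ ht hfix
  ext x
  have hx := MulEquiv.congr_fun hg x
  rw [MulEquiv.trans_apply, MulEquiv.refl_apply] at hx
  -- `g₂.symm (g₁ x) = x` ⇒ `g₁ x = g₂ x`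
  simpa using congrArg g₂ hx

end Monoprime

end Literature.AlgebraicGeometry.Frobenioids
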